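import Summits.Langlands.Langlands.Theses.CongruenceGraphSplit

/-!
# Glue of the generation-1 split of `InsolubleComponentAnchor` (route CongruenceGraphSplit, rev 1)

Closes the glue item `stmt-Langlands-28161` of `route-Langlands-CongruenceGraphSplit`:
`InsolubleComponentAnchor_of_doors : KleinDoorReach → DoorlessComponentAnchor →
InsolubleComponentAnchor`.
Pure logic — excluded middle on «`n = 2` and the family passes a Klein door»: the door-less cell
concludes outright unless `n = 2` and the (inlined) Klein-door predicate holds, in which case the
Klein-door cell concludes.  This is the lens-3 node proof
`KleinDoorSplit.insolubleComponentAnchor_of_pieces` (decomp-langlands, 2026-08-30; certified against a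
mock render in the node's kit check), transported to the tree's declarations.  No definitions, no new
mathematics.
-/

set_option linter.dupNamespace false -- project-wide option; `Summit.Langlands.Langlands` is the mandated namespace

namespace Summit.Langlands.Langlands.Theorems

open Summit.Langlands.Langlands.Theses.CongruenceGraphSplit in
/-- The glue item `stmt-Langlands-28161` of route CongruenceGraphSplit (rev 1): the two children
`KleinDoorReach` (rank-2 families passing a Klein door at 5 or at 2) and `DoorlessComponentAnchor`
(everything else) of the split of `InsolubleComponentAnchor` imply the parent.  Proof: by
contradiction; the door-less cell applies unless `n = 2` and the door predicate holds, and then the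
Klein-door cell applies. -/
theorem InsolubleComponentAnchor_of_doors_proof :
    Summit.Langlands.Langlands.Theses.CongruenceGraphSplit.InsolubleComponentAnchor_of_doors := by
  intro hD hC K _ _ n hcpt hn a ha
  by_contra hno
  refine hno (hC K n hcpt hn a ha fun hn2 hdoor => ?_)
  subst hn2
  exact hno (hD K hcpt a ha hdoor)

end Summit.Langlands.Langlands.Theorems
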